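/-
Copyright (c) 2026. All rights reserved.
Released under Apache 2.0 license as described in the file LICENSE.
Authors: abc-iut cell, F-wave prover seat abc-iut-f-101 (gen 4), over part 1 (`LogFrobeniusMonoEtaComponents.lean`) and the
files cited there.
-/
import Literature.AnabelianGeometry.AbsoluteAnabelian.LogFrobeniusMonoEtaComponents
import Literature.AnabelianGeometry.AbsoluteAnabelian.AbsTopIII.MLFGaloisMonoAnabelianPerfections
import HarnessLib

/-!
# [AbsTopIII] Cor 5.10 (iv)(c): NATURALITY of the components of `η⊢_{v,ν}` at the genuine nonarchimedean mono-analytic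
# model in Galois-isomorphisms of the holomorphic model (the four vertices of `Γ⃗×_non`)

S. Mochizuki, *Topics in absolute anabelian geometry III: global reconstruction algorithms*, J. Math. Sci. Univ.
Tokyo 22 (2015) 939–1156 [MochizukiAbsTopIII2015]; locators = pages of the author's manuscript
(`paper:url-5493eb38cbb7`), read on the page: Cor 5.10 (iv)(c) p. 148 ("isomorphisms `η⊢_{v,ν}` … between the composites"
— i.e. NATURAL isomorphisms of functors), Prop 5.8 (ii)/(vii) pp. 139–142 (the containers are "functorial [i.e., relative
to `TG⊢`]"), Def 3.1 (ii) p. 67 (Galois-isomorphisms of pairs), Def 5.6 (ii)/(iii) pp. 135–136 (mono-analyticization).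

## What this file builds (node [AbsTopIII] Cor 5.10 (iv), layer L4; row «MTC-GENUINE-POSITIVE», part 2: naturality)

For a Galois-isomorphism `f : A ⟶ B` of abc-iut-L4-t9's holomorphic model (both objects with OPEN augmentation) the four
component isomorphisms of part 1 commute with the two functorial actions of `f`: on the mono-analytic side abc-iut-w6-d036's
/ this seat's containers `kbarUnits`, `kbarTimes`, `kbarUnitsPf`, `kbarTimesPf` applied to `toMonoBase.map f = conj(σ_f)`
(whose arithmetic component is the canonical LCFT transport, identified with `σ_f` by part 1's `transport_toMonoBase_map`),
and on the holomorphic side `TSObj.monoAn.map` of `lamUnits.map f`, `lamTimes.map f`, `lamAdd.map f`, `lamTimesPf.map f`: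

* `homIso_toMonoBase_map_aug` — `conj(σ_f) (ε_A g) = ε_B (φ_Π g)` (the augmentations are intertwined);
* `etaUnitsIso_naturality`, `etaTimesIso_naturality`, ★ `etaShellIso_naturality` (the logarithm commutes with `σ_f`:
  abc-iut-L4-t9's `Hom.log_galois`), `etaPerfIso_naturality` — the naturality squares in `𝒞_TS`.

These are exactly the squares needed to package the components into the NATURAL isomorphisms `η⊢_{v,ν}` of abc-iut-L4-t3's
`MonoTelecoreCoherence.eta` over abc-iut-w5-d053's open-augmentation sub-model (part 3).  HONEST FRAMING: MODEL-LEVEL;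
classical local class field theory and the `p`-adic logarithm as proved in the tree; refereed pre-IUT material; nothing
here bears on [IUTchIII] Cor. 3.12; no side taken; typed ≠ proved.
-/

set_option autoImplicit false

noncomputable section

namespace Literature.AnabelianGeometry.AbsoluteAnabelian

open CategoryTheory Topology
open Literature.NumberTheory.Transcendental
open scoped nonZeroDivisors

namespace AbsTopIII

namespace TFModel

variable {p : ℕ} [Fact p.Prime] {A B : TFModel p} (hA : IsOpenMap A.D.aug) (hB : IsOpenMap B.D.aug)

/-- The MLF closure data `(k, ℚ̄_p)` of a model object as an object of abc-iut-w6-d036's mono-analytic base (= `toMonoBase.obj`).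
[cite: MochizukiAbsTopIII2015, Definition 5.6 (ii) p.135] -/
abbrev closureObj (A : TFModel p) : MLFClosure.MonoBase := closure A

/-- `conj(σ_f)`: abc-iut-w6-d036's `toMonoBase.map f`, typed as a morphism `closure A ⟶ closure B` of the mono-analytic base
(same term; the explicit typing keeps the containers' values at `closure A`, `closure B` on the nose).
[cite: MochizukiAbsTopIII2015, Definition 5.6 (ii) p.135] -/
abbrev closureMap (f : A ⟶ B) : closureObj A ⟶ closureObj B := (toMonoBase p).map f

/-- **The augmentations are intertwined by `conj(σ_f)`**: `(toMonoBase.map f) (ε_A g) = ε_B (φ_Π g)` in `Gal(ℚ̄_p/k_B)`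
(abc-iut-L4-t9's `augQ_homPi` read through abc-iut-w6-d036's `toMonoBase_map_iso_apply`).
[cite: MochizukiAbsTopIII2015, Definition 3.1 (ii) p.67] -/
theorem homIso_toMonoBase_map_aug (f : A ⟶ B) (g : A.pair.Pi) :
    MLFClosure.homIso (closureMap f) (A.D.aug g) = B.D.aug ((f : Hom A B).hom.homPi g) := by
  apply AlgEquiv.ext
  intro x
  change (f : Hom A B).galois (A.augQ g ((f : Hom A B).galois.symm x)) = B.augQ ((f : Hom A B).hom.homPi g) x
  rw [Hom.augQ_homPi]
  rfl

/-- The Galois legs commute: `η_B ∘ conj(σ_f) = (φ_Π mod Ker) ∘ η_A` on `ε_A g` — common to all four vertices (stated for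
any pair of vertex kernels). [cite: MochizukiAbsTopIII2015, Cor 5.10 (iv)(c) p. 148] -/
theorem augQuotientIso_symm_naturality (f : A ⟶ B) (NA : Subgroup A.pair.Pi) [NA.Normal] (hNA : NA = A.pair.actionKer)
    (NB : Subgroup B.pair.Pi) [NB.Normal] (hNB : NB = B.pair.actionKer) (h : NA ≤ NB.comap (f : Hom A B).hom.homPi)
    (σ : PadicAlgCl p ≃ₐ[A.k] PadicAlgCl p) :
    (B.augQuotientIso NB hNB hB).symm (MLFClosure.homIso (closureMap f) σ) =
      QuotientGroup.map NA NB (f : Hom A B).hom.homPi h ((A.augQuotientIso NA hNA hA).symm σ) := by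
  obtain ⟨g, rfl⟩ := A.D.aug_surjective σ
  rw [homIso_toMonoBase_map_aug, augQuotientIso_symm_aug, augQuotientIso_symm_aug]
  rfl

/-! ## `ν = 𝒪^×` -/

/-- **Naturality of `η⊢` at `𝒪^×`**: `kbarUnits(conj σ_f) ≫ η_B = η_A ≫ monoAn(λ_{𝒪^×}(f))` in `𝒞_TS`.
[cite: MochizukiAbsTopIII2015, Cor 5.10 (iv)(c) p. 148] -/
theorem etaUnitsIso_naturality (f : A ⟶ B) :
    MLFClosure.kbarUnits.map (closureMap f) ≫ (B.etaUnitsIso hB).hom =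
      (A.etaUnitsIso hA).hom ≫ TSObj.monoAn.map ((lamUnits p).map f) := by
  refine TSObj.Hom.ext (MonoidHom.ext fun σ => ?_) (funext fun x => UnitsCarrier.ext ?_)
  · haveI : @Subgroup.Normal A.pair.Pi _ A.lamUnitsObj.actionKer := TSObj.actionKer_normal A.lamUnitsObj
    haveI : @Subgroup.Normal B.pair.Pi _ B.lamUnitsObj.actionKer := TSObj.actionKer_normal B.lamUnitsObj
    exact augQuotientIso_symm_naturality hA hB f _ A.lamUnitsObj_actionKer _ B.lamUnitsObj_actionKer
      (TSObj.Hom.comap_ker ((lamUnits p).map f)).ge σ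
  · change (MLFClosure.unitsTransport (MLFClosure.homIso (closureMap f))
        (show ↥(unitSubmonoid (closure A).k (closure A).K) from x)).1 =
      (f : Hom A B).galois (show ↥(unitSubmonoid (closure A).k (closure A).K) from x).1
    exact Hom.transport_toMonoBase_map (f : Hom A B) _

/-! ## `ν = k̄^×` -/

/-- **Naturality of `η⊢` at `k̄^×`**: `kbarTimes(conj σ_f) ≫ η_B = η_A ≫ monoAn(λ^×(f))`.
[cite: MochizukiAbsTopIII2015, Cor 5.10 (iv)(c) p. 148] -/
theorem etaTimesIso_naturality (f : A ⟶ B) :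
    MLFClosure.kbarTimes.map (closureMap f) ≫ (B.etaTimesIso hB).hom =
      (A.etaTimesIso hA).hom ≫ TSObj.monoAn.map ((lamTimes p).map f) := by
  refine TSObj.Hom.ext (MonoidHom.ext fun σ => ?_) (funext fun x => TimesCarrier.ext ?_)
  · haveI : @Subgroup.Normal A.pair.Pi _ A.lamTimesObj.actionKer := TSObj.actionKer_normal A.lamTimesObj
    haveI : @Subgroup.Normal B.pair.Pi _ B.lamTimesObj.actionKer := TSObj.actionKer_normal B.lamTimesObj
    exact augQuotientIso_symm_naturality hA hB f _ A.lamTimesObj_actionKer _ B.lamTimesObj_actionKer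
      (TSObj.Hom.comap_ker ((lamTimes p).map f)).ge σ
  · exact Hom.transport_toMonoBase_map (f : Hom A B) _

/-! ## `ν = k~` -/

/-- **Naturality of `η⊢` at `k~`**: `kbarUnitsPf(conj σ_f) ≫ η_B = η_A ≫ monoAn(λ_{k~}(f))` — the logarithm commutes with
`σ_f` (abc-iut-L4-t9's `Hom.log_galois`) and the transport on `𝒪^× ⧸ μ` is `σ_f mod μ`.
[cite: MochizukiAbsTopIII2015, Cor 5.10 (iv)(c) p. 148] -/
theorem etaShellIso_naturality (f : A ⟶ B) :
    MLFClosure.kbarUnitsPf.map (closureMap f) ≫ (B.etaShellIso hB).hom =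
      (A.etaShellIso hA).hom ≫ TSObj.monoAn.map ((lamAdd p).map f) := by
  refine TSObj.Hom.ext (MonoidHom.ext fun σ => ?_) (funext fun x => ?_)
  · haveI : @Subgroup.Normal A.pair.Pi _ A.lamAddObj.actionKer := TSObj.actionKer_normal A.lamAddObj
    haveI : @Subgroup.Normal B.pair.Pi _ B.lamAddObj.actionKer := TSObj.actionKer_normal B.lamAddObj
    exact augQuotientIso_symm_naturality hA hB f _ A.lamAddObj_actionKer _ B.lamAddObj_actionKer
      (TSObj.Hom.comap_ker ((lamAdd p).map f)).ge σ
  · induction x using QuotientGroup.induction_on with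
    | H u =>
      apply AddCarrier.ext
      have hu : (u : ((closure A).K)ˣ).1 ≠ 0 := (u : ((closure A).K)ˣ).ne_zero
      have key : padicLogAlgCl p (MLFClosure.transport (MLFClosure.homIso (closureMap f))
            ((MLFClosure.unitsOfNonZero (closure A)).symm (u : ((closure A).K)ˣ))).1 =
          (f : Hom A B).galois (padicLogAlgCl p (u : ((closure A).K)ˣ).1) := by
        rw [Hom.transport_toMonoBase_map, MLFClosure.coe_unitsOfNonZero_symm, Hom.log_galois _ hu]
      exact key

/-! ## `ν = (k̄^×)^pf` -/

/-- **Naturality of `η⊢` at `(k̄^×)^pf`**: `kbarTimesPf(conj σ_f) ≫ η_B = η_A ≫ monoAn(λ^{×pf}(f))`.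
[cite: MochizukiAbsTopIII2015, Cor 5.10 (iv)(c) p. 148] -/
theorem etaPerfIso_naturality (f : A ⟶ B) :
    MLFClosure.kbarTimesPf.map (closureMap f) ≫ (B.etaPerfIso hB).hom =
      (A.etaPerfIso hA).hom ≫ TSObj.monoAn.map ((lamTimesPf p).map f) := by
  refine TSObj.Hom.ext (MonoidHom.ext fun σ => ?_) (funext fun x => ?_)
  · haveI : @Subgroup.Normal A.pair.Pi _ A.lamTimesPfObj.actionKer := TSObj.actionKer_normal A.lamTimesPfObj
    haveI : @Subgroup.Normal B.pair.Pi _ B.lamTimesPfObj.actionKer := TSObj.actionKer_normal B.lamTimesPfObj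
    exact augQuotientIso_symm_naturality hA hB f _ A.lamTimesPfObj_actionKer _ B.lamTimesPfObj_actionKer
      (TSObj.Hom.comap_ker ((lamTimesPf p).map f)).ge σ
  · induction x using QuotientGroup.induction_on with
    | H u =>
      change timesToPf (TimesCarrier.ofUnits
          (MLFClosure.transportUnits (MLFClosure.homIso (closureMap f)) u)) =
        timesToPf (unitsGal (f : Hom A B).galois (TimesCarrier.ofUnits u))
      exact congrArg timesToPf (TimesCarrier.ext (Hom.transport_toMonoBase_map (f : Hom A B) _))

/-- Summary: the four components of `η⊢_{v,ν}` are NATURAL in Galois-isomorphisms of open-augmentation objects — the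
content of "isomorphisms between the composites [functors]" in Cor 5.10 (iv)(c), vertex by vertex.
[cite: MochizukiAbsTopIII2015, Cor 5.10 (iv)(c) p. 148] -/
theorem eta_components_natural (f : A ⟶ B) :
    MLFClosure.kbarUnits.map (closureMap f) ≫ (B.etaUnitsIso hB).hom =
        (A.etaUnitsIso hA).hom ≫ TSObj.monoAn.map ((lamUnits p).map f) ∧
      MLFClosure.kbarTimes.map (closureMap f) ≫ (B.etaTimesIso hB).hom =
        (A.etaTimesIso hA).hom ≫ TSObj.monoAn.map ((lamTimes p).map f) ∧
      MLFClosure.kbarUnitsPf.map (closureMap f) ≫ (B.etaShellIso hB).hom =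
        (A.etaShellIso hA).hom ≫ TSObj.monoAn.map ((lamAdd p).map f) ∧
      MLFClosure.kbarTimesPf.map (closureMap f) ≫ (B.etaPerfIso hB).hom =
        (A.etaPerfIso hA).hom ≫ TSObj.monoAn.map ((lamTimesPf p).map f) :=
  ⟨etaUnitsIso_naturality hA hB f, etaTimesIso_naturality hA hB f, etaShellIso_naturality hA hB f,
    etaPerfIso_naturality hA hB f⟩

end TFModel

end AbsTopIII

end Literature.AnabelianGeometry.AbsoluteAnabelian

end
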